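import Literature.AnabelianGeometry.Anabelioids.ComponentDecomposition
import Literature.AnabelianGeometry.SemiGraphs.CoveringComparison

/-!
# The comparison functor `B(𝒢)_{/A} ⥤ B(𝒢_A)` is faithful ([SemiAnbd] Def. 2.2 (i), global clause — brick G6(a))

Mochizuki, *Semi-graphs of anabelioids*, Publ. RIMS **42** (2006) 221–322, §2 p. 23
[cite: MochizukiSemiAnbd2006, Def. 2.2(i) p.23].  A morphism `X → Y` over `A` is determined by its
vertex and edge components `X_v → Y_v`, `X_e → Y_e`, and `X_v` is the COPRODUCT of its pieces
`X_v ×_{S_v} P` over the connected components `P` of `S_v` (`Anabelioids.isColimit_cofan_pullback_components`,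
extensivity of Galois categories); the piece over `P` is read off from the `(v, P)`-component of
`toCovering A`.  Hence `BObj.toCovering A : Over A ⥤ B(𝒢_A)` is faithful (`toCovering_faithful`).
-/

namespace Literature.AnabelianGeometry.SemiGraphs

namespace SemiGraphOfAnabelioids

open CategoryTheory CategoryTheory.Limits CategoryTheory.PreGaloisCategory
open Literature.AnabelianGeometry.Anabelioids

universe w' w v₁ u₁ u

-- Mathlib's `Over.pullback` / `Over.star` simp lemmas (`pullback.lift_fst`, …) only fire under the
-- pre-v4.2x defeq transparency behaviour, exactly as in `Mathlib/CategoryTheory/Comma/Over/Pullback.lean`.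
set_option backward.isDefEq.respectTransparency false

namespace BObj

variable {𝒢 : SemiGraphOfAnabelioids.{v₁, u₁, u}} (A : 𝒢.BObj)

/-- Vertex components of `toCovering A` on morphisms: `f ↦ f_v ×_{S_v} P` inside the model.
[cite: MochizukiSemiAnbd2006, Def. 2.2(i) p.23] -/
theorem toCovering_map_fS {X Y : Over A} (f : X ⟶ Y) (vc : A.fibreData.total.Vertex) :
    (A.toCovering.map f).fS vc = (A.toV vc).map ((A.toCoveringV vc).map f) :=
  rfl

/-- Edge components of `toCovering A` on morphisms. [cite: MochizukiSemiAnbd2006, Def. 2.2(i) p.23] -/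
theorem toCovering_map_fT {X Y : Over A} (f : X ⟶ Y) (ec : A.fibreData.total.Edge) :
    (A.toCovering.map f).fT ec = (A.toE ec).map ((A.toCoveringE ec).map f) :=
  rfl

/-- Every connected component of `S_v` is the component attached to some vertex of `𝔾_A` over `v`.
[cite: MochizukiSemiAnbd2006, Def. 2.2(i) p.23] -/
theorem exists_vComp_eq (v : 𝒢.graph.Vertex) (P : π₀Obj (A.S v)) :
    ∃ c : Shrink.{u} (π₀Obj (A.S v)), P = A.vComp ⟨v, c⟩ :=
  ⟨equivShrink _ P, (Equiv.symm_apply_apply _ _).symm⟩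

/-- Every connected component of `T_e` is the component attached to some edge of `𝔾_A` over `e`.
[cite: MochizukiSemiAnbd2006, Def. 2.2(i) p.23] -/
theorem exists_eComp_eq (e : 𝒢.graph.Edge) (Q : π₀Obj (A.T e)) :
    ∃ c : Shrink.{u} (π₀Obj (A.T e)), Q = A.eComp ⟨e, c⟩ :=
  ⟨equivShrink _ Q, (Equiv.symm_apply_apply _ _).symm⟩

/-- **`toCovering A : B(𝒢)_{/A} ⥤ B(𝒢_A)` is faithful**: a morphism over `A` is recovered from its
pieces `X_v ×_{S_v} P → Y_v ×_{S_v} P`, `X_v` being the coproduct of the `X_v ×_{S_v} P`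
(extensivity). [cite: MochizukiSemiAnbd2006, Def. 2.2(i) p.23] -/
theorem toCovering_faithful : (A.toCovering).Faithful := by
  refine ⟨fun {X Y} f g hfg => ?_⟩
  have hV : ∀ vc, (A.toCoveringV vc).map f = (A.toCoveringV vc).map g := fun vc =>
    (Shrink.equivalence (Over ((A.vComp vc).1 : 𝒢.V (A.fibreData.proj.vertexMap vc)))).functor.map_injective
      (congrArg (fun m => BObj.Hom.fS m vc) hfg)
  have hE : ∀ ec, (A.toCoveringE ec).map f = (A.toCoveringE ec).map g := fun ec =>
    (Shrink.equivalence (Over ((A.eComp ec).1 : 𝒢.E (A.fibreData.proj.edgeMap ec)))).functor.map_injective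
      (congrArg (fun m => BObj.Hom.fT m ec) hfg)
  apply Over.OverMorphism.ext
  apply BObj.hom_ext
  · funext v
    obtain ⟨hc⟩ := isColimit_cofan_pullback_components (X.hom.fS v)
    refine Cofan.IsColimit.hom_ext hc _ _ (fun P => ?_)
    obtain ⟨c, rfl⟩ := A.exists_vComp_eq v P
    have e := congrArg (fun m => m.left ≫ pullback.fst _ _) (hV ⟨v, c⟩)
    simp only [toCoveringV_map_left_fst] at e
    exact e
  · funext e'
    obtain ⟨hc⟩ := isColimit_cofan_pullback_components (X.hom.fT e')
    refine Cofan.IsColimit.hom_ext hc _ _ (fun Q => ?_)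
    obtain ⟨c, rfl⟩ := A.exists_eComp_eq e' Q
    have e := congrArg (fun m => m.left ≫ pullback.fst _ _) (hE ⟨e', c⟩)
    simp only [toCoveringE_map_left_fst] at e
    exact e

end BObj

end SemiGraphOfAnabelioids

end Literature.AnabelianGeometry.SemiGraphs
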